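/-
Literature/Analysis/Quadrature/ScrambledNetVariancePiL2.lean

The variance of Owen-scrambled nets in dimension `s` for square-integrable integrands:
Theorem 13.6 (Owen's gain-coefficient formula), Owen's `(t, m, s)`-net bound, Corollary 13.7 and
Theorem 13.9 of Dick–Pillichshammer for `f ∈ L_2` of the `s`-dimensional digit space (the passage
from Walsh polynomials to `L_2` by Parseval's identity, eq. (13.12)).
-/
import Mathlib
import Literature.Analysis.Quadrature.ScrambledDigitalNetVariance
import Literature.Analysis.Quadrature.WalshCompletenessPi

/-!
# The variance of scrambled nets in dimension `s` for square-integrable integrands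

[DickPillichshammer2010] J. Dick, F. Pillichshammer, *Digital Nets and Sequences. Discrepancy
Theory and Quasi-Monte Carlo Integration*, Cambridge University Press 2010, §13.1
(Proposition 13.1 and the display following it, pp. 398–399: the randomised QMC rule is unbiased),
§13.3.2 "The case of arbitrary dimension `s`", pp. 407–412: eq. (13.12)
`Var[f] = Σ_{𝐤 ∈ ℕ₀ˢ∖{0}} |f̂(𝐤)|²`, the classes `L_𝓵`, `σ_𝓵²(f) = Σ_{𝐤 ∈ L_𝓵} |f̂(𝐤)|²`, the
numbers `G_𝓵` ("Owen [207] called the numbers `Γ_𝓵 := N² G_𝓵` gain coefficients"),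
**Theorem 13.6** ("from Owen [207]": `Var[Î(f)] = Σ_{𝓵 ∈ ℕ₀ˢ∖{0}} G_𝓵 σ_𝓵²(f)` for
`f ∈ L_2([0,1]ˢ)` and ANY point set), **Corollary 13.7** (digital nets: `G_𝓵` through
`|L_𝓵 ∩ 𝓓_∞|`), Lemma 13.8 and **Theorem 13.9** (`Var[Î(f)] ≤ b^{-m+t+s} Σ_{|𝓵|_1 > m-t} σ_𝓵²(f)`
for a scrambled digital `(t, m, s)`-net; the remark after it: "the gain coefficients `Γ_𝓵` are `0`
for `|𝓵|_1 ≤ m - t`"; for MC `N Var[Î(f)] = Σ_{𝓵 ≠ 0} σ_𝓵²(f)`).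
* A. B. Owen, *Scrambled net variance for integrals of smooth functions*, Ann. Statist. 25 (1997);
  A. B. Owen, *Monte Carlo variance of scrambled net quadrature*, SIAM J. Numer. Anal. 34 (1997)
  ([DP2010, ref. 207]); A. B. Owen, *Scrambling Sobol' and Niederreiter–Xing points*,
  J. Complexity 14 (1998), 466–489 [Owen1998, Thm. 1] (eq. (12): for a scrambled `(t, m, s)`-net
  `V(Î) ≤ b^t ((b+1)/(b-1))^s σ²/n`).
* C. Lemieux, *Monte Carlo and Quasi-Monte Carlo Sampling*, Springer 2009 [Lemieux2009, Prop. 6.4]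
  (the same bound).

The tree proves all of these for WALSH POLYNOMIALS `f = Σ_{𝐤 ∈ [0,b^L)ˢ} c_𝐤 wal_𝐤` on the digit
space: `ScrambledNetGainCoefficients` (Theorem 13.6 as
`integral_norm_sq_scrambledAveragePi_sub_eq_sum`, Owen's net bound
`IsDigitNetPi.integral_norm_sq_scrambledAveragePi_sub_le`) and `ScrambledDigitalNetVariance`
(Corollary 13.7, Theorem 13.9; its docstrings: "the passage to `L_2` is Parseval's identity, not
formalised here"), while `WalshCompletenessPi` proves Parseval / (13.12) on
the `s`-dimensional digit space (`hasSum_blockVariancePi_walshCoeffDPi_ite`). This file performs the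
passage to `L_2`. Throughout, `f ∈ L_2` of the digit space (`MemLp f 2 (digitSeqMeasurePi b ι)`,
`ι` a finite type of coordinates, `s = |ι|`), `σ_𝓵²(f) = blockVariancePi b (walshCoeffDPi b f) 𝓵`,
`Î(f) = scrambledAveragePi b Π ξ f` the randomised QMC estimator over the points with digit
sequences `ξ n i` (point `n ∈ κ`, `N = |κ|`, coordinate `i`), scrambled coordinate-wise by
independent uniform nested scrambles `Π = (Π_i)_i` (law `scrambleMeasurePi b ι`), and `N² G_𝓵 =
gainFactorPi b 𝓵 ξ`:

* `measurePreserving_scrambleDigitsPi`, `integral_scrambledAveragePi` — Proposition 13.1 on the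
  digit space (a coordinate-wise scrambled point is uniformly distributed) and unbiasedness
  `E[Î(f)] = ∫ f` for integrable `f`;
* `integral_norm_sq_scrambledAveragePi_le` — `E|Î(g)|² ≤ ∫ |g|²` (`g ∈ L_2`) [folklore];
* `hasSum_gainFactorPi_mul_blockVariancePi` — **Theorem 13.6 for `f ∈ L_2`**:
  `Var[Î(f)] = E|Î(f) - ∫ f|² = Σ_{𝓵 ∈ ℕ₀ˢ∖{0}} G_𝓵 σ_𝓵²(f)`, an unconditionally convergent series;
* `IsDigitNetPi.hasSum_gainFactorPi_mul_blockVariancePi_of_memLp`,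
  `IsDigitNetPi.integral_norm_sq_scrambledAveragePi_sub_le_tsum_of_memLp`,
  `IsDigitNetPi.integral_norm_sq_scrambledAveragePi_sub_le_of_memLp` — for a scrambled
  `(t, m, s)`-net only `|𝓵|_1 > m - t` contributes, and **Owen's bound for `f ∈ L_2`**:
  `Var[Î(f)] ≤ b^t/b^m ((b+1)/(b-1))^s Σ_{|𝓵|_1 > m-t} σ_𝓵²(f) ≤ b^t/b^m ((b+1)/(b-1))^s Var[f]`;
* `hasSum_gainWeight_mul_card_mul_blockVariancePi` — **Corollary 13.7 for `f ∈ L_2`**;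
* `IsDigitalTMSNet.hasSum_gainWeight_mul_card_mul_blockVariancePi_of_memLp`,
  `IsDigitalTMSNet.integral_norm_sq_scrambledAveragePi_sub_le_tsum_of_memLp`,
  `IsDigitalTMSNet.integral_norm_sq_scrambledAveragePi_sub_le_of_memLp` — **Theorem 13.9 for
  `f ∈ L_2`**: `Var[Î(f)] ≤ b^{-m+t+s} Σ_{|𝓵|_1 > m-t} σ_𝓵²(f) ≤ b^{-m+t+s} Var[f]`.

Method. `E_{(L,…,L)} f = S_{[0,b^L)ˢ}(·, f)` is the Walsh polynomial with coefficients `f̂(𝐤)`,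
`𝐤 ∈ [0,b^L)ˢ` (`sum_walshCoeffDPi_mul_walshDPi`), to which the tree theorems apply; `Î` is linear
and `E|Î(f - E_L f)|² ≤ ∫ |f - E_L f|² → 0` (`tendsto_integral_norm_sq_sub_levelMeanPi`), so
`E|Î(E_L f) - ∫ f|² → E|Î(f) - ∫ f|²` by an elementary squeeze, and the left-hand sides are the
partial sums of the (non-negative) series over the cubes `[0,L]ˢ`, which exhaust `ℕ₀ˢ`.

Modelling notes. (1) As in the files this one extends, everything is on the digit space
`ι → ℕ → Fin b` with the product digit law (the law of the digits of a uniform point of `[0,1)ˢ`),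
for an arbitrary base `b ≥ 2` (the book takes `b` prime in §13.3.2; nothing below needs it), any
precision `p` of the generating matrices, and a finite index type `κ` of points. (2) "Variance"
means the centred second moment `E|Î(f) - ∫ f|²`, the variance by unbiasedness
(`integral_scrambledAveragePi`). (3) Complex-valued `f`. (4) The book's "`Γ_𝓵 = b^{t+s}` for
`|𝓵|_1 > m - t`" is the upper bound `Γ_𝓵 ≤ b^{t+s}` produced by Lemma 13.8, which is what
Theorem 13.9 uses (`IsDigitalTMSNet.gainFactorPi_le_card`).

AI-produced formalisation (H21 engines group, seat eng-quad-1, 2026-08-21); no facts, no axioms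
beyond Mathlib's, no `sorry`.
-/

open MeasureTheory Complex Finset Filter Topology

open scoped ComplexConjugate ENNReal

noncomputable section

namespace Literature.Analysis.Quadrature

variable {b : ℕ} {ι : Type*} [Fintype ι]

/-! ### An elementary squeeze: `L_2`-convergence implies convergence of second moments -/

section Squeeze

variable {α : Type*} [MeasurableSpace α] {ν : Measure α}

/-- `2xy ≤ t x² + y²/t` for `t > 0`. [folklore] -/
private theorem two_mul_mul_le_of_pos' {t : ℝ} (ht : 0 < t) (x y : ℝ) :
    2 * x * y ≤ t * x ^ 2 + t⁻¹ * y ^ 2 := by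
  have ht' : t ≠ 0 := ht.ne'
  have h : t * x ^ 2 + t⁻¹ * y ^ 2 - 2 * x * y = t⁻¹ * (t * x - y) ^ 2 := by
    field_simp
    ring
  have h2 : 0 ≤ t⁻¹ * (t * x - y) ^ 2 := by positivity
  linarith

/-- `|u|² ≤ (1 + t)|v|² + (1 + 1/t)|u - v|²` for `t > 0`. [folklore] -/
private theorem norm_sq_le_of_pos' {t : ℝ} (ht : 0 < t) (u v : ℂ) :
    ‖u‖ ^ 2 ≤ ‖v‖ ^ 2 + t * ‖v‖ ^ 2 + (1 + t⁻¹) * ‖u - v‖ ^ 2 := by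
  have h1 : ‖u‖ ≤ ‖v‖ + ‖u - v‖ := norm_le_norm_add_norm_sub' u v
  have h2 : ‖u‖ ^ 2 ≤ (‖v‖ + ‖u - v‖) ^ 2 := pow_le_pow_left₀ (norm_nonneg u) h1 2
  have h3 := two_mul_mul_le_of_pos' ht ‖v‖ ‖u - v‖
  nlinarith [h2, h3]

/-- `|F|²` is integrable for `F ∈ L_2`. [folklore] -/
private theorem integrable_norm_sq_of_memLp_two' {F : α → ℂ} (hF : MemLp F 2 ν) :
    Integrable (fun x => ‖F x‖ ^ 2) ν :=
  (memLp_two_iff_integrable_sq_norm hF.1).1 hF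

/-- **Second moments are continuous along `L_2`-convergent sequences**: if `a, u_L ∈ L_2` and
`∫ |a - u_L|² → 0`, then `∫ |u_L|² → ∫ |a|²`. (Elementary squeeze avoiding square roots: integrate
`|u|² ≤ (1+t)|a|² + (1+1/t)|u - a|²` and the same with `a, u` exchanged, then let `t → 0`.)
[folklore] -/
private theorem tendsto_integral_norm_sq_of_sub' {a : α → ℂ} {u : ℕ → α → ℂ} (ha : MemLp a 2 ν)
    (hu : ∀ L, MemLp (u L) 2 ν)
    (hD : Tendsto (fun L => ∫ x, ‖a x - u L x‖ ^ 2 ∂ν) atTop (𝓝 0)) :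
    Tendsto (fun L => ∫ x, ‖u L x‖ ^ 2 ∂ν) atTop (𝓝 (∫ x, ‖a x‖ ^ 2 ∂ν)) := by
  set A := ∫ x, ‖a x‖ ^ 2 ∂ν with hA_def
  have hA : 0 ≤ A := integral_nonneg fun x => sq_nonneg _
  have hIa : Integrable (fun x => ‖a x‖ ^ 2) ν := integrable_norm_sq_of_memLp_two' ha
  rw [Metric.tendsto_atTop]
  intro ε hε
  -- the auxiliary parameter `t`
  set t : ℝ := min (1 / 2) (ε / (8 * (A + 1))) with ht_def
  have ht0 : 0 < t := lt_min (by norm_num) (by positivity)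
  have ht_half : t ≤ 1 / 2 := min_le_left _ _
  have htA : t * A ≤ ε / 8 := by
    have h1 : t ≤ ε / (8 * (A + 1)) := min_le_right _ _
    calc t * A ≤ ε / (8 * (A + 1)) * A := mul_le_mul_of_nonneg_right h1 hA
      _ ≤ ε / (8 * (A + 1)) * (A + 1) :=
          mul_le_mul_of_nonneg_left (by linarith) (by positivity)
      _ = ε / 8 := by field_simp
  set K : ℝ := 1 + t⁻¹ with hK_def
  have hK : 0 < K := by positivity
  obtain ⟨N, hN⟩ := (Metric.tendsto_atTop.1 hD) (ε / 4 / K) (by positivity)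
  refine ⟨N, fun L hL => ?_⟩
  set B := ∫ x, ‖u L x‖ ^ 2 ∂ν with hB_def
  set D := ∫ x, ‖a x - u L x‖ ^ 2 ∂ν with hD_def
  have hB : 0 ≤ B := integral_nonneg fun x => sq_nonneg _
  have hD0 : 0 ≤ D := integral_nonneg fun x => sq_nonneg _
  have hKD : K * D < ε / 4 := by
    have h := hN L hL
    rw [Real.dist_eq, sub_zero, abs_of_nonneg hD0] at h
    rwa [lt_div_iff₀ hK, mul_comm] at h
  have hIu : Integrable (fun x => ‖u L x‖ ^ 2) ν := integrable_norm_sq_of_memLp_two' (hu L)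
  have hId : Integrable (fun x => ‖a x - u L x‖ ^ 2) ν :=
    integrable_norm_sq_of_memLp_two' (ha.sub (hu L))
  have hI3 : Integrable (fun x => K * ‖a x - u L x‖ ^ 2) ν := hId.const_mul K
  -- `B ≤ (1 + t) A + K D`
  have h1 : B ≤ A + t * A + K * D := by
    have hI4 : Integrable (fun x => t * ‖a x‖ ^ 2) ν := hIa.const_mul t
    have hI2 : Integrable (fun x => ‖a x‖ ^ 2 + t * ‖a x‖ ^ 2) ν := hIa.add hI4
    have hI : Integrable (fun x => ‖a x‖ ^ 2 + t * ‖a x‖ ^ 2 + K * ‖a x - u L x‖ ^ 2) ν :=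
      hI2.add hI3
    calc B ≤ ∫ x, (‖a x‖ ^ 2 + t * ‖a x‖ ^ 2 + K * ‖a x - u L x‖ ^ 2) ∂ν :=
          integral_mono hIu hI fun x => by
            have h := norm_sq_le_of_pos' ht0 (u L x) (a x)
            rw [norm_sub_rev (u L x) (a x)] at h
            exact h
      _ = A + t * A + K * D := by
          rw [integral_add hI2 hI3, integral_add hIa hI4, integral_const_mul, integral_const_mul]
  -- `A ≤ (1 + t) B + K D`
  have h2 : A ≤ B + t * B + K * D := by
    have hI4 : Integrable (fun x => t * ‖u L x‖ ^ 2) ν := hIu.const_mul t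
    have hI2 : Integrable (fun x => ‖u L x‖ ^ 2 + t * ‖u L x‖ ^ 2) ν := hIu.add hI4
    have hI : Integrable (fun x => ‖u L x‖ ^ 2 + t * ‖u L x‖ ^ 2 + K * ‖a x - u L x‖ ^ 2) ν :=
      hI2.add hI3
    calc A ≤ ∫ x, (‖u L x‖ ^ 2 + t * ‖u L x‖ ^ 2 + K * ‖a x - u L x‖ ^ 2) ∂ν :=
          integral_mono hIa hI fun x => norm_sq_le_of_pos' ht0 (a x) (u L x)
      _ = B + t * B + K * D := by
          rw [integral_add hI2 hI3, integral_add hIu hI4, integral_const_mul, integral_const_mul]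
  rw [Real.dist_eq, abs_sub_lt_iff]
  constructor
  · linarith
  · have htB : t * B ≤ t * A + t * (t * A) + t * (K * D) := by
      have h := mul_le_mul_of_nonneg_left h1 ht0.le
      linarith
    have e1 : t * (t * A) ≤ 1 / 2 * (ε / 8) :=
      mul_le_mul ht_half htA (by positivity) (by norm_num)
    have e2 : t * (K * D) ≤ 1 / 2 * (ε / 4) :=
      mul_le_mul ht_half hKD.le (by positivity) (by norm_num)
    linarith

end Squeeze

/-! ### Unconditional sums over `ℕ₀ˢ` from the cubes `[0,L]ˢ` -/

section Cubes

variable [DecidableEq ι]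

omit [Fintype ι] [DecidableEq ι] in
/-- Unconditional sums of a non-negative family from bounded finite sums and ONE exhausting
sequence of finite sets along which the sums converge to the bound. [folklore] -/
private theorem hasSum_of_sum_le_of_tendsto' {α : Type*} {g : α → ℝ} {a : ℝ} (hg : ∀ x, 0 ≤ g x)
    (hle : ∀ S : Finset α, ∑ x ∈ S, g x ≤ a) (T : ℕ → Finset α)
    (hT : Tendsto (fun n => ∑ x ∈ T n, g x) atTop (𝓝 a)) : HasSum g a := by
  have hsum : Summable g := summable_of_sum_le hg hle
  have h1 : ∑' x, g x ≤ a := hsum.tsum_le_of_sum_le hle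
  have h2 : a ≤ ∑' x, g x :=
    le_of_tendsto' hT fun n => hsum.sum_le_tsum (T n) fun x _ => hg x
  have h : ∑' x, g x = a := le_antisymm h1 h2
  exact h ▸ hsum.hasSum

/-- Every finite set of digit-length vectors lies in a cube `[0,L]ˢ`. [folklore] -/
private theorem exists_subset_piFinset_range (F : Finset (ι → ℕ)) :
    ∃ L, F ⊆ Fintype.piFinset fun _ : ι => range (L + 1) := by
  refine ⟨F.sup fun ℓ => univ.sup ℓ, fun ℓ hℓ => Fintype.mem_piFinset.2 fun i =>
    mem_range.2 (Nat.lt_succ_of_le ?_)⟩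
  exact (Finset.le_sup (f := ℓ) (mem_univ i)).trans
    (Finset.le_sup (f := fun ℓ : ι → ℕ => univ.sup ℓ) hℓ)

/-- The cubes `[0,L]ˢ` increase with `L`. [folklore] -/
private theorem piFinset_range_mono {L L' : ℕ} (h : L ≤ L') :
    (Fintype.piFinset fun _ : ι => range (L + 1)) ⊆ Fintype.piFinset fun _ : ι => range (L' + 1) :=
  Fintype.piFinset_subset _ _ fun _ => range_subset_range.2 (by omega)

/-- **A non-negative family on `ℕ₀ˢ` whose sums over the cubes `[0,L]ˢ` converge is
unconditionally summable to the limit.** [folklore] -/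
private theorem hasSum_of_tendsto_sum_piFinset {g : (ι → ℕ) → ℝ} {a : ℝ} (hg : ∀ ℓ, 0 ≤ g ℓ)
    (hT : Tendsto (fun L => ∑ ℓ ∈ Fintype.piFinset (fun _ : ι => range (L + 1)), g ℓ) atTop
      (𝓝 a)) :
    HasSum g a := by
  have hmono : Monotone fun L => ∑ ℓ ∈ Fintype.piFinset (fun _ : ι => range (L + 1)), g ℓ :=
    fun L L' h => sum_le_sum_of_subset_of_nonneg (piFinset_range_mono h) fun ℓ _ _ => hg ℓ
  refine hasSum_of_sum_le_of_tendsto' hg (fun S => ?_) _ hT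
  obtain ⟨L, hL⟩ := exists_subset_piFinset_range S
  exact (sum_le_sum_of_subset_of_nonneg hL fun ℓ _ _ => hg ℓ).trans (hmono.ge_of_tendsto hT L)

end Cubes

/-! ### Proposition 13.1 on the digit space: transfer of integrals and of `L_p` -/

section Transfer

variable [NeZero b]

omit [Fintype ι] [NeZero b] in
/-- `Π ↦ ξ_Π` is measurable for a fixed digit sequence `ξ`. [folklore] -/
private theorem measurable_scrambleDigits_fixed' (ξ : ℕ → Fin b) :
    Measurable fun π : Scramble b => scrambleDigits b π ξ :=
  measurable_pi_lambda _ fun k =>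
    (measurable_from_top (f := fun p : Equiv.Perm (Fin b) => p (ξ k))).comp
      (measurable_pi_apply (⟨k, digitsPrefix b k ξ⟩ : (k : ℕ) × (Fin k → Fin b)))

omit [Fintype ι] [NeZero b] in
/-- `Π = (Π_i)_i ↦ ζ_Π = ((ζ_i)_{Π_i})_i` is measurable for a fixed `s`-tuple of digit sequences.
[folklore] -/
private theorem measurable_scrambleDigitsPi_fixed (ζ : ι → ℕ → Fin b) :
    Measurable fun π : ι → Scramble b => scrambleDigitsPi b π ζ :=
  measurable_pi_lambda _ fun i =>
    (measurable_scrambleDigits_fixed' (ζ i)).comp (measurable_pi_apply i)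

/-- **Proposition 13.1 on the digit space**: for EVERY `s`-tuple of digit sequences `ζ`, the
coordinate-wise scrambled point `ζ_Π = ((ζ_1)_{Π_1}, …, (ζ_s)_{Π_s})` of `s` independent uniform
nested scrambles is uniformly distributed, i.e. `Π ↦ ζ_Π` pushes the scramble law forward to the
product digit law ("the coordinates are randomised independently", the one-dimensional case being
`map_scrambleDigits_scrambleMeasure`). [cite: DickPillichshammer2010, Prop. 13.1] -/
theorem measurePreserving_scrambleDigitsPi (ζ : ι → ℕ → Fin b) :
    MeasurePreserving (fun π : ι → Scramble b => scrambleDigitsPi b π ζ) (scrambleMeasurePi b ι)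
      (digitSeqMeasurePi b ι) := by
  have h : ∀ i, MeasurePreserving (fun π : Scramble b => scrambleDigits b π (ζ i))
      (scrambleMeasure b) (digitSeqMeasure b) := fun i =>
    ⟨measurable_scrambleDigits_fixed' (ζ i), map_scrambleDigits_scrambleMeasure b (ζ i)⟩
  have hpi := measurePreserving_pi (fun _ : ι => scrambleMeasure b)
    (fun _ : ι => digitSeqMeasure b) h
  unfold scrambleMeasurePi digitSeqMeasurePi scrambleDigitsPi
  exact hpi

/-- The law of a coordinate-wise scrambled point is the product digit law.
[cite: DickPillichshammer2010, Prop. 13.1] -/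
theorem map_scrambleDigitsPi_scrambleMeasurePi (ζ : ι → ℕ → Fin b) :
    (scrambleMeasurePi b ι).map (fun π : ι → Scramble b => scrambleDigitsPi b π ζ) =
      digitSeqMeasurePi b ι :=
  (measurePreserving_scrambleDigitsPi ζ).map_eq

/-- A function in `L_p` of the digit space, evaluated at a scrambled point, is in `L_p` of the
scramble space. [cite: DickPillichshammer2010, Prop. 13.1] -/
private theorem memLp_comp_scrambleDigitsPi {p : ℝ≥0∞} {g : (ι → ℕ → Fin b) → ℂ}
    (hg : MemLp g p (digitSeqMeasurePi b ι)) (ζ : ι → ℕ → Fin b) :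
    MemLp (fun π : ι → Scramble b => g (scrambleDigitsPi b π ζ)) p (scrambleMeasurePi b ι) := by
  have hg' : MemLp g p
      ((scrambleMeasurePi b ι).map fun π : ι → Scramble b => scrambleDigitsPi b π ζ) := by
    rw [map_scrambleDigitsPi_scrambleMeasurePi ζ]
    exact hg
  exact hg'.comp_of_map (measurable_scrambleDigitsPi_fixed ζ).aemeasurable

/-- `∫ g(ζ_Π) dΠ = ∫ g`: a scrambled point is uniformly distributed.
[cite: DickPillichshammer2010, Prop. 13.1] -/
private theorem integral_comp_scrambleDigitsPi {g : (ι → ℕ → Fin b) → ℂ}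
    (hg : AEStronglyMeasurable g (digitSeqMeasurePi b ι)) (ζ : ι → ℕ → Fin b) :
    ∫ π, g (scrambleDigitsPi b π ζ) ∂scrambleMeasurePi b ι = ∫ η, g η ∂digitSeqMeasurePi b ι := by
  have hφ : AEMeasurable (fun π : ι → Scramble b => scrambleDigitsPi b π ζ)
      (scrambleMeasurePi b ι) := (measurable_scrambleDigitsPi_fixed ζ).aemeasurable
  have hF : AEStronglyMeasurable g
      ((scrambleMeasurePi b ι).map fun π : ι → Scramble b => scrambleDigitsPi b π ζ) := by
    rw [map_scrambleDigitsPi_scrambleMeasurePi ζ]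
    exact hg
  calc ∫ π, g (scrambleDigitsPi b π ζ) ∂scrambleMeasurePi b ι
      = ∫ η, g η ∂((scrambleMeasurePi b ι).map fun π : ι → Scramble b =>
          scrambleDigitsPi b π ζ) := (integral_map hφ hF).symm
    _ = ∫ η, g η ∂digitSeqMeasurePi b ι := by rw [map_scrambleDigitsPi_scrambleMeasurePi ζ]

/-- `∫ |g(ζ_Π)|² dΠ = ∫ |g|²`. [cite: DickPillichshammer2010, Prop. 13.1] -/
private theorem integral_norm_sq_comp_scrambleDigitsPi {g : (ι → ℕ → Fin b) → ℂ}
    (hg : AEStronglyMeasurable g (digitSeqMeasurePi b ι)) (ζ : ι → ℕ → Fin b) :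
    ∫ π, ‖g (scrambleDigitsPi b π ζ)‖ ^ 2 ∂scrambleMeasurePi b ι =
      ∫ η, ‖g η‖ ^ 2 ∂digitSeqMeasurePi b ι := by
  have hφ : AEMeasurable (fun π : ι → Scramble b => scrambleDigitsPi b π ζ)
      (scrambleMeasurePi b ι) := (measurable_scrambleDigitsPi_fixed ζ).aemeasurable
  have hF : AEStronglyMeasurable (fun η => ‖g η‖ ^ 2)
      ((scrambleMeasurePi b ι).map fun π : ι → Scramble b => scrambleDigitsPi b π ζ) := by
    rw [map_scrambleDigitsPi_scrambleMeasurePi ζ]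
    exact (continuous_pow 2).comp_aestronglyMeasurable hg.norm
  calc ∫ π, ‖g (scrambleDigitsPi b π ζ)‖ ^ 2 ∂scrambleMeasurePi b ι
      = ∫ η, ‖g η‖ ^ 2 ∂((scrambleMeasurePi b ι).map fun π : ι → Scramble b =>
          scrambleDigitsPi b π ζ) := (integral_map hφ hF).symm
    _ = ∫ η, ‖g η‖ ^ 2 ∂digitSeqMeasurePi b ι := by rw [map_scrambleDigitsPi_scrambleMeasurePi ζ]

variable {κ : Type*} [Fintype κ]

/-- **Unbiasedness of the scrambled estimator in dimension `s`**, `E[Î(f)] = ∫ f`, for every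
integrable `f` on the digit space and every point set. [cite: DickPillichshammer2010, Prop. 13.1]
(and the display following it in §13.1, p. 399: `E[(1/N) Σ_n f(y_n)] = ∫_{[0,1]ˢ} f(x) dx`, "an
unbiased estimator"; `integral_scrambledAveragePi_walshPolyPi` is the case of a Walsh
polynomial.) -/
theorem integral_scrambledAveragePi [Nonempty κ] (ξ : κ → ι → ℕ → Fin b)
    {f : (ι → ℕ → Fin b) → ℂ} (hf : Integrable f (digitSeqMeasurePi b ι)) :
    ∫ π, scrambledAveragePi b π ξ f ∂scrambleMeasurePi b ι = ∫ η, f η ∂digitSeqMeasurePi b ι := by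
  have hI : ∀ n, Integrable (fun π : ι → Scramble b => f (scrambleDigitsPi b π (ξ n)))
      (scrambleMeasurePi b ι) := fun n =>
    memLp_one_iff_integrable.1
      (memLp_comp_scrambleDigitsPi (memLp_one_iff_integrable.2 hf) (ξ n))
  simp only [scrambledAveragePi]
  rw [integral_const_mul, integral_finsetSum _ fun n _ => hI n]
  simp_rw [integral_comp_scrambleDigitsPi hf.1]
  rw [sum_const, card_univ, nsmul_eq_mul, ← mul_assoc,
    inv_mul_cancel₀ (Nat.cast_ne_zero.2 Fintype.card_ne_zero), one_mul]

omit [Fintype ι] [NeZero b] in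
/-- `Î` is linear: `Î(f - g) = Î(f) - Î(g)`. [folklore] -/
private theorem scrambledAveragePi_sub (π : ι → Scramble b) (ξ : κ → ι → ℕ → Fin b)
    (f g : (ι → ℕ → Fin b) → ℂ) :
    scrambledAveragePi b π ξ (f - g) = scrambledAveragePi b π ξ f - scrambledAveragePi b π ξ g := by
  simp only [scrambledAveragePi, Pi.sub_apply, sum_sub_distrib, mul_sub]

/-- `Î(f) ∈ L_p` of the scramble space for `f ∈ L_p` of the digit space. [folklore] -/
private theorem memLp_scrambledAveragePi (ξ : κ → ι → ℕ → Fin b) {f : (ι → ℕ → Fin b) → ℂ}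
    {p : ℝ≥0∞} (hf : MemLp f p (digitSeqMeasurePi b ι)) :
    MemLp (fun π : ι → Scramble b => scrambledAveragePi b π ξ f) p (scrambleMeasurePi b ι) := by
  unfold scrambledAveragePi
  exact (memLp_finsetSum _ fun n _ => memLp_comp_scrambleDigitsPi hf (ξ n)).const_mul _

omit [Fintype ι] [NeZero b] in
/-- Jensen: `|Î(g)|² ≤ (1/N) Σ_n |g((ξ_n)_Π)|²`. [folklore] -/
private theorem norm_sq_scrambledAveragePi_le [Nonempty κ] (π : ι → Scramble b)
    (ξ : κ → ι → ℕ → Fin b) (g : (ι → ℕ → Fin b) → ℂ) :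
    ‖scrambledAveragePi b π ξ g‖ ^ 2 ≤
      (Fintype.card κ : ℝ)⁻¹ * ∑ n, ‖g (scrambleDigitsPi b π (ξ n))‖ ^ 2 := by
  have hN : (Fintype.card κ : ℝ) ≠ 0 := Nat.cast_ne_zero.2 Fintype.card_ne_zero
  rw [scrambledAveragePi, norm_mul, norm_inv, Complex.norm_natCast, mul_pow, inv_pow]
  have h1 : ‖∑ n, g (scrambleDigitsPi b π (ξ n))‖ ^ 2 ≤
      (∑ n, ‖g (scrambleDigitsPi b π (ξ n))‖) ^ 2 :=
    pow_le_pow_left₀ (norm_nonneg _) (norm_sum_le _ _) 2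
  have h2 : (∑ n, ‖g (scrambleDigitsPi b π (ξ n))‖) ^ 2 ≤
      (Fintype.card κ : ℝ) * ∑ n, ‖g (scrambleDigitsPi b π (ξ n))‖ ^ 2 := by
    have h := sq_sum_le_card_mul_sum_sq (s := (univ : Finset κ))
      (f := fun n => ‖g (scrambleDigitsPi b π (ξ n))‖)
    rwa [card_univ] at h
  calc ((Fintype.card κ : ℝ) ^ 2)⁻¹ * ‖∑ n, g (scrambleDigitsPi b π (ξ n))‖ ^ 2
      ≤ ((Fintype.card κ : ℝ) ^ 2)⁻¹ *
          ((Fintype.card κ : ℝ) * ∑ n, ‖g (scrambleDigitsPi b π (ξ n))‖ ^ 2) :=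
        mul_le_mul_of_nonneg_left (h1.trans h2) (by positivity)
    _ = (Fintype.card κ : ℝ)⁻¹ * ∑ n, ‖g (scrambleDigitsPi b π (ξ n))‖ ^ 2 := by
        rw [pow_two, mul_inv, mul_assoc, inv_mul_cancel_left₀ hN]

/-- **`E|Î(g)|² ≤ ∫ |g|²`** for `g ∈ L_2` of the digit space and every point set — by Jensen's
inequality and the uniform distribution of each scrambled point (Proposition 13.1): the randomised
estimator is an `L_2`-contraction. [folklore] (consequence of
[cite: DickPillichshammer2010, Prop. 13.1]) -/
theorem integral_norm_sq_scrambledAveragePi_le [Nonempty κ] (ξ : κ → ι → ℕ → Fin b)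
    {g : (ι → ℕ → Fin b) → ℂ} (hg : MemLp g 2 (digitSeqMeasurePi b ι)) :
    ∫ π, ‖scrambledAveragePi b π ξ g‖ ^ 2 ∂scrambleMeasurePi b ι ≤
      ∫ η, ‖g η‖ ^ 2 ∂digitSeqMeasurePi b ι := by
  have hN : (Fintype.card κ : ℝ) ≠ 0 := Nat.cast_ne_zero.2 Fintype.card_ne_zero
  have hI : ∀ n, Integrable (fun π : ι → Scramble b => ‖g (scrambleDigitsPi b π (ξ n))‖ ^ 2)
      (scrambleMeasurePi b ι) := fun n =>
    integrable_norm_sq_of_memLp_two' (memLp_comp_scrambleDigitsPi hg (ξ n))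
  have hIS : Integrable (fun π : ι → Scramble b => ∑ n, ‖g (scrambleDigitsPi b π (ξ n))‖ ^ 2)
      (scrambleMeasurePi b ι) := integrable_finsetSum _ fun n _ => hI n
  have hIs : Integrable (fun π : ι → Scramble b =>
      (Fintype.card κ : ℝ)⁻¹ * ∑ n, ‖g (scrambleDigitsPi b π (ξ n))‖ ^ 2)
      (scrambleMeasurePi b ι) := hIS.const_mul _
  calc ∫ π, ‖scrambledAveragePi b π ξ g‖ ^ 2 ∂scrambleMeasurePi b ι
      ≤ ∫ π, (Fintype.card κ : ℝ)⁻¹ * ∑ n, ‖g (scrambleDigitsPi b π (ξ n))‖ ^ 2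
          ∂scrambleMeasurePi b ι :=
        integral_mono (integrable_norm_sq_of_memLp_two' (memLp_scrambledAveragePi ξ hg)) hIs
          fun π => norm_sq_scrambledAveragePi_le π ξ g
    _ = (Fintype.card κ : ℝ)⁻¹ * ∑ n : κ, ∫ η, ‖g η‖ ^ 2 ∂digitSeqMeasurePi b ι := by
        rw [integral_const_mul, integral_finsetSum _ fun n _ => hI n]
        simp_rw [integral_norm_sq_comp_scrambleDigitsPi hg.1]
    _ = ∫ η, ‖g η‖ ^ 2 ∂digitSeqMeasurePi b ι := by
        rw [sum_const, card_univ, nsmul_eq_mul, ← mul_assoc, inv_mul_cancel₀ hN, one_mul]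

end Transfer

/-! ### Theorem 13.6 and Owen's `(t, m, s)`-net bound for square-integrable integrands -/

section MainL2

variable [NeZero b] [DecidableEq ι] {κ : Type*} [Fintype κ]

omit [DecidableEq ι] in
/-- The multivariate Walsh functions are measurable on the digit space. [folklore] -/
private theorem measurable_walshDPi' (k : ι → ℕ) : Measurable (walshDPi b k) := by
  change Measurable fun η : ι → ℕ → Fin b => ∏ i, walshD b (k i) (η i)
  exact Finset.measurable_prod _ fun i _ => (measurable_walshD (k i)).comp (measurable_pi_apply i)

/-- `E_{(L,…,L)} f = S_{[0,b^L)ˢ}(·, f)` is the Walsh polynomial of degree `< b^L` per coordinate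
with coefficients `f̂(𝐤)`. [cite: DickPillichshammer2010, Lemma A.17] (proof of Thm. A.11,
p. 549) -/
theorem walshPolyPi_walshCoeffDPi_eq_levelMeanPi (hb : 1 < b) {f : (ι → ℕ → Fin b) → ℂ}
    (hf : Integrable f (digitSeqMeasurePi b ι)) (L : ℕ) :
    walshPolyPi b L (walshCoeffDPi b f) = levelMeanPi b (fun _ : ι => L) f :=
  funext fun η => sum_walshCoeffDPi_mul_walshDPi hb hf (fun _ : ι => L) η

/-- A multivariate Walsh polynomial is in every `L_p`. [folklore] -/
private theorem memLp_walshPolyPi (L : ℕ) (c : (ι → ℕ) → ℂ) (p : ℝ≥0∞) :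
    MemLp (walshPolyPi b L c) p (digitSeqMeasurePi b ι) := by
  have hmeas : Measurable (walshPolyPi b L c) :=
    Finset.measurable_sum (Fintype.piFinset fun _ : ι => range (b ^ L)) fun k _ =>
      (measurable_walshDPi' k).const_mul (c k)
  refine MemLp.of_bound hmeas.aestronglyMeasurable
    (∑ k ∈ Fintype.piFinset (fun _ : ι => range (b ^ L)), ‖c k‖) (ae_of_all _ fun η => ?_)
  calc ‖walshPolyPi b L c η‖
      ≤ ∑ k ∈ Fintype.piFinset (fun _ : ι => range (b ^ L)), ‖c k * walshDPi b k η‖ :=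
        norm_sum_le _ _
    _ = ∑ k ∈ Fintype.piFinset (fun _ : ι => range (b ^ L)), ‖c k‖ :=
        sum_congr rfl fun k _ => by rw [norm_mul, norm_walshDPi, mul_one]

/-- `E_{(L,…,L)} f ∈ L_p` for integrable `f` (it is a Walsh polynomial). [folklore] -/
private theorem memLp_levelMeanPi (hb : 1 < b) {f : (ι → ℕ → Fin b) → ℂ}
    (hf : Integrable f (digitSeqMeasurePi b ι)) (L : ℕ) (p : ℝ≥0∞) :
    MemLp (levelMeanPi b (fun _ : ι => L) f) p (digitSeqMeasurePi b ι) := by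
  rw [← walshPolyPi_walshCoeffDPi_eq_levelMeanPi hb hf L]
  exact memLp_walshPolyPi L _ p

/-- **The centred second moments of `Î(E_{(L,…,L)} f)` converge to that of `Î(f)`** as
`L → ∞`, for `f ∈ L_2` of the digit space, any point set and any centre `z` — since
`E|Î(f - E_L f)|² ≤ ∫ |f - E_L f|² → 0`. [folklore] (from
[cite: DickPillichshammer2010, Thm. A.19] (3), `s`-dimensional, and Prop. 13.1) -/
theorem tendsto_integral_norm_sq_scrambledAveragePi_levelMeanPi (hb : 1 < b) [Nonempty κ]
    (ξ : κ → ι → ℕ → Fin b) {f : (ι → ℕ → Fin b) → ℂ} (hf : MemLp f 2 (digitSeqMeasurePi b ι))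
    (z : ℂ) :
    Tendsto (fun L => ∫ π, ‖scrambledAveragePi b π ξ (levelMeanPi b (fun _ : ι => L) f) - z‖ ^ 2
        ∂scrambleMeasurePi b ι)
      atTop (𝓝 (∫ π, ‖scrambledAveragePi b π ξ f - z‖ ^ 2 ∂scrambleMeasurePi b ι)) := by
  have hfI : Integrable f (digitSeqMeasurePi b ι) := hf.integrable one_le_two
  have hLmem : ∀ L, MemLp (levelMeanPi b (fun _ : ι => L) f) 2 (digitSeqMeasurePi b ι) :=
    fun L => memLp_levelMeanPi hb hfI L 2
  have ha : MemLp (fun π : ι → Scramble b => scrambledAveragePi b π ξ f - z) 2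
      (scrambleMeasurePi b ι) := (memLp_scrambledAveragePi ξ hf).sub (memLp_const z)
  have hu : ∀ L, MemLp (fun π : ι → Scramble b =>
      scrambledAveragePi b π ξ (levelMeanPi b (fun _ : ι => L) f) - z) 2
      (scrambleMeasurePi b ι) := fun L =>
    (memLp_scrambledAveragePi ξ (hLmem L)).sub (memLp_const z)
  refine tendsto_integral_norm_sq_of_sub' ha hu ?_
  have hle : ∀ L, ∫ π, ‖(scrambledAveragePi b π ξ f - z) -
      (scrambledAveragePi b π ξ (levelMeanPi b (fun _ : ι => L) f) - z)‖ ^ 2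
        ∂scrambleMeasurePi b ι ≤
      ∫ η, ‖(f - levelMeanPi b (fun _ : ι => L) f) η‖ ^ 2 ∂digitSeqMeasurePi b ι := fun L => by
    have heq : ∀ π : ι → Scramble b, (scrambledAveragePi b π ξ f - z) -
        (scrambledAveragePi b π ξ (levelMeanPi b (fun _ : ι => L) f) - z) =
        scrambledAveragePi b π ξ (f - levelMeanPi b (fun _ : ι => L) f) := fun π => by
      rw [scrambledAveragePi_sub, sub_sub_sub_cancel_right]
    simp_rw [heq]
    exact integral_norm_sq_scrambledAveragePi_le ξ (hf.sub (hLmem L))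
  exact squeeze_zero (fun L => integral_nonneg fun π => sq_nonneg _) hle
    (tendsto_integral_norm_sq_sub_levelMeanPi hb hf)

omit [NeZero b] in
/-- `σ_𝓵² ≥ 0`. [folklore] -/
private theorem blockVariancePi_nonneg (c : (ι → ℕ) → ℂ) (ℓ : ι → ℕ) :
    0 ≤ blockVariancePi b c ℓ :=
  sum_nonneg fun _ _ => sq_nonneg _

omit [NeZero b] in
/-- `0 ∈ [0,L]ˢ`. [folklore] -/
private theorem zero_mem_piFinset_range (L : ℕ) :
    (0 : ι → ℕ) ∈ Fintype.piFinset fun _ : ι => range (L + 1) :=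
  Fintype.mem_piFinset.2 fun _ => mem_range.2 (Nat.succ_pos L)

/-- **Theorem 13.6 for `f ∈ L_2`** [cite: DickPillichshammer2010, Thm. 13.6] ("from Owen [207]"):
let `f ∈ L_2`, `b ≥ 2`, and let the points `x_0, …, x_{N-1} ∈ [0,1)ˢ` (ANY point set, digit
sequences `ξ n i`) be randomised by Owen's scrambling (independent uniform nested scrambles in the
coordinates). Then the randomised QMC estimator `Î(f)` has variance
`Var[Î(f)] = E|Î(f) - ∫ f|² = Σ_{𝓵 ∈ ℕ₀ˢ ∖ {0}} G_𝓵 σ_𝓵²(f)`,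
`G_𝓵 = N⁻² Σ_{n,n'} ∏_i (b χ[⌊b^{ℓ_i} x_{n,i}⌋ = ⌊b^{ℓ_i} x_{n',i}⌋] - χ[⌊b^{ℓ_i-1} x_{n,i}⌋ =
⌊b^{ℓ_i-1} x_{n',i}⌋])/(b-1)` and `σ_𝓵²(f) = Σ_{𝐤 ∈ L_𝓵} |f̂(𝐤)|²` — the series over `ℕ₀ˢ`
converging unconditionally (its terms are `≥ 0`, `gainFactorPi_nonneg`; the term `𝓵 = 0` is set to
`0`). The case of a Walsh polynomial is `integral_norm_sq_scrambledAveragePi_sub_eq_sum`. -/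
theorem hasSum_gainFactorPi_mul_blockVariancePi (hb : 1 < b) [Nonempty κ] (ξ : κ → ι → ℕ → Fin b)
    {f : (ι → ℕ → Fin b) → ℂ} (hf : MemLp f 2 (digitSeqMeasurePi b ι)) :
    HasSum (fun ℓ : ι → ℕ => if ℓ = 0 then 0 else
        ((Fintype.card κ : ℝ) ^ 2)⁻¹ *
          (gainFactorPi b ℓ ξ * blockVariancePi b (walshCoeffDPi b f) ℓ))
      (∫ π, ‖scrambledAveragePi b π ξ f - ∫ η, f η ∂digitSeqMeasurePi b ι‖ ^ 2
        ∂scrambleMeasurePi b ι) := by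
  have hfI : Integrable f (digitSeqMeasurePi b ι) := hf.integrable one_le_two
  have hnn : ∀ ℓ : ι → ℕ, 0 ≤ (if ℓ = 0 then (0 : ℝ) else ((Fintype.card κ : ℝ) ^ 2)⁻¹ *
      (gainFactorPi b ℓ ξ * blockVariancePi b (walshCoeffDPi b f) ℓ)) := fun ℓ => by
    split_ifs
    · exact le_rfl
    · exact mul_nonneg (by positivity)
        (mul_nonneg (gainFactorPi_nonneg hb ℓ ξ) (blockVariancePi_nonneg _ ℓ))
  refine hasSum_of_tendsto_sum_piFinset hnn
    ((tendsto_integral_norm_sq_scrambledAveragePi_levelMeanPi hb ξ hf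
      (∫ η, f η ∂digitSeqMeasurePi b ι)).congr fun L => ?_)
  rw [← add_sum_erase _ _ (zero_mem_piFinset_range L), if_pos rfl, zero_add,
    ← walshPolyPi_walshCoeffDPi_eq_levelMeanPi hb hfI L, ← walshCoeffDPi_zero_eq_integral f,
    integral_norm_sq_scrambledAveragePi_sub_eq_sum hb ξ L (walshCoeffDPi b f), mul_sum]
  exact sum_congr rfl fun ℓ hℓ => (if_neg (mem_erase.1 hℓ).1).symm

/-- **Theorem 13.6 for `f ∈ L_2`, `tsum` form** [cite: DickPillichshammer2010, Thm. 13.6]: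
`E|Î(f) - ∫ f|² = Σ'_{𝓵 ≠ 0} N⁻² (N² G_𝓵) σ_𝓵²(f)`. -/
theorem integral_norm_sq_scrambledAveragePi_sub_eq_tsum (hb : 1 < b) [Nonempty κ]
    (ξ : κ → ι → ℕ → Fin b) {f : (ι → ℕ → Fin b) → ℂ} (hf : MemLp f 2 (digitSeqMeasurePi b ι)) :
    ∫ π, ‖scrambledAveragePi b π ξ f - ∫ η, f η ∂digitSeqMeasurePi b ι‖ ^ 2 ∂scrambleMeasurePi b ι =
      ∑' ℓ : ι → ℕ, if ℓ = 0 then 0 else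
        ((Fintype.card κ : ℝ) ^ 2)⁻¹ *
          (gainFactorPi b ℓ ξ * blockVariancePi b (walshCoeffDPi b f) ℓ) :=
  (hasSum_gainFactorPi_mul_blockVariancePi hb ξ hf).tsum_eq.symm

omit [DecidableEq ι] in
/-- A `(t, m, s)`-net has at least one point (`N = b^m`). [folklore] -/
private theorem IsDigitNetPi.nonempty' {t m : ℕ} {ξ : κ → ι → ℕ → Fin b}
    (h : IsDigitNetPi b t m ξ) : Nonempty κ :=
  Fintype.card_pos_iff.1 (h.2.1 ▸ Nat.pow_pos (Nat.pos_of_ne_zero (NeZero.ne b)))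

/-- **Variance of a scrambled `(t, m, s)`-net for `f ∈ L_2`, exact form**
[cite: DickPillichshammer2010, Thm. 13.6] with Owen's Lemma 2 (the remark after Theorem 13.9,
p. 412: the gain coefficients vanish for `|𝓵|_1 ≤ m - t`); [cite: Owen1998, Thm. 1] (proof): for
`f ∈ L_2` and a `(t, m, s)`-net in base `b` randomised by Owen's scrambling, only the digit-length
vectors with `|𝓵|_1 > m - t` contribute:
`Var[Î(f)] = E|Î(f) - ∫ f|² = Σ_{𝓵 ∈ ℕ₀ˢ, |𝓵|_1 > m-t} G_𝓵 σ_𝓵²(f)`. -/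
theorem IsDigitNetPi.hasSum_gainFactorPi_mul_blockVariancePi_of_memLp (hb : 1 < b) {t m : ℕ}
    {ξ : κ → ι → ℕ → Fin b} (h : IsDigitNetPi b t m ξ) {f : (ι → ℕ → Fin b) → ℂ}
    (hf : MemLp f 2 (digitSeqMeasurePi b ι)) :
    HasSum (fun ℓ : ι → ℕ => if ∑ i, ℓ i ≤ m - t then 0 else
        ((Fintype.card κ : ℝ) ^ 2)⁻¹ *
          (gainFactorPi b ℓ ξ * blockVariancePi b (walshCoeffDPi b f) ℓ))
      (∫ π, ‖scrambledAveragePi b π ξ f - ∫ η, f η ∂digitSeqMeasurePi b ι‖ ^ 2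
        ∂scrambleMeasurePi b ι) := by
  haveI := h.nonempty'
  have heq : (fun ℓ : ι → ℕ => if ∑ i, ℓ i ≤ m - t then (0 : ℝ) else
      ((Fintype.card κ : ℝ) ^ 2)⁻¹ *
        (gainFactorPi b ℓ ξ * blockVariancePi b (walshCoeffDPi b f) ℓ)) =
      fun ℓ => if ℓ = 0 then 0 else ((Fintype.card κ : ℝ) ^ 2)⁻¹ *
        (gainFactorPi b ℓ ξ * blockVariancePi b (walshCoeffDPi b f) ℓ) := by
    funext ℓ
    by_cases hℓ0 : ℓ = 0
    · subst hℓ0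
      simp
    · rw [if_neg hℓ0]
      split_ifs with hle
      · rw [h.gainFactorPi_eq_zero hb hℓ0 hle, zero_mul, mul_zero]
      · rfl
  rw [heq]
  exact hasSum_gainFactorPi_mul_blockVariancePi hb ξ hf

/-- Owen's bound on one term: `N⁻² (N² G_𝓵) x ≤ b^t/b^m ((b+1)/(b-1))^s x` for `𝓵 ≠ 0`, `x ≥ 0`.
[cite: Owen1998, Thm. 1] (eq. (12)) -/
private theorem IsDigitNetPi.inv_sq_mul_gainFactorPi_mul_le (hb : 1 < b) {t m : ℕ}
    {ξ : κ → ι → ℕ → Fin b} (h : IsDigitNetPi b t m ξ) {ℓ : ι → ℕ} (hℓ0 : ℓ ≠ 0) {x : ℝ}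
    (hx : 0 ≤ x) :
    ((Fintype.card κ : ℝ) ^ 2)⁻¹ * (gainFactorPi b ℓ ξ * x) ≤
      (b : ℝ) ^ t / (b : ℝ) ^ m * (((b : ℝ) + 1) / ((b : ℝ) - 1)) ^ Fintype.card ι * x := by
  have hG := h.gainFactorPi_le_card_mul hb hℓ0
  rw [h.2.1] at hG ⊢
  push_cast at hG ⊢
  have hB : (b : ℝ) ^ m ≠ 0 := pow_ne_zero _ (by exact_mod_cast (NeZero.ne b))
  calc (((b : ℝ) ^ m) ^ 2)⁻¹ * (gainFactorPi b ℓ ξ * x)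
      ≤ (((b : ℝ) ^ m) ^ 2)⁻¹ * (((b : ℝ) ^ m * (b : ℝ) ^ t *
          (((b : ℝ) + 1) / ((b : ℝ) - 1)) ^ Fintype.card ι) * x) :=
        mul_le_mul_of_nonneg_left (mul_le_mul_of_nonneg_right hG hx) (by positivity)
    _ = (b : ℝ) ^ t / (b : ℝ) ^ m * (((b : ℝ) + 1) / ((b : ℝ) - 1)) ^ Fintype.card ι * x := by
        field_simp

/-- The tail family `σ_𝓵²(f) [|𝓵|_1 > m - t]` of the nested ANOVA variances of `f ∈ L_2` is
summable (by (13.12)). [cite: DickPillichshammer2010, eq. (13.12)] -/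
theorem summable_blockVariancePi_walshCoeffDPi_ite (hb : 1 < b) {f : (ι → ℕ → Fin b) → ℂ}
    (hf : MemLp f 2 (digitSeqMeasurePi b ι)) (P : (ι → ℕ) → Prop) [DecidablePred P] :
    Summable fun ℓ : ι → ℕ => if P ℓ then 0 else blockVariancePi b (walshCoeffDPi b f) ℓ :=
  Summable.of_nonneg_of_le
    (fun ℓ => by
      split_ifs
      · exact le_rfl
      · exact blockVariancePi_nonneg _ ℓ)
    (fun ℓ => by
      split_ifs
      · exact blockVariancePi_nonneg _ ℓ
      · exact le_rfl)
    (hasSum_blockVariancePi_walshCoeffDPi hb hf).summable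

/-- **Owen's variance bound for a scrambled `(t, m, s)`-net, `f ∈ L_2`** [cite: Owen1998, Thm. 1]
(eq. (12): `V(Î) ≤ b^t ((b+1)/(b-1))^s σ²/n`, here in the sharper tail form of its proof);
[cite: Lemieux2009, Prop. 6.4]; [cite: DickPillichshammer2010, Thm. 13.6] with the bound
`N G_𝓵 ≤ b^t ((b+1)/(b-1))^s`: for `f ∈ L_2`, `b ≥ 2`, and a `(t, m, s)`-net in base `b`
(`N = b^m` points) randomised by Owen's scrambling,
`Var[Î(f)] = E|Î(f) - ∫ f|² ≤ (b^t/b^m) ((b+1)/(b-1))^s Σ_{𝓵 ∈ ℕ₀ˢ, |𝓵|_1 > m-t} σ_𝓵²(f)`. -/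
theorem IsDigitNetPi.integral_norm_sq_scrambledAveragePi_sub_le_tsum_of_memLp (hb : 1 < b)
    {t m : ℕ} {ξ : κ → ι → ℕ → Fin b} (h : IsDigitNetPi b t m ξ) {f : (ι → ℕ → Fin b) → ℂ}
    (hf : MemLp f 2 (digitSeqMeasurePi b ι)) :
    ∫ π, ‖scrambledAveragePi b π ξ f - ∫ η, f η ∂digitSeqMeasurePi b ι‖ ^ 2 ∂scrambleMeasurePi b ι ≤
      (b : ℝ) ^ t / (b : ℝ) ^ m * (((b : ℝ) + 1) / ((b : ℝ) - 1)) ^ Fintype.card ι *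
        ∑' ℓ : ι → ℕ, if ∑ i, ℓ i ≤ m - t then 0 else blockVariancePi b (walshCoeffDPi b f) ℓ := by
  haveI := h.nonempty'
  refine hasSum_le (fun ℓ => ?_) (h.hasSum_gainFactorPi_mul_blockVariancePi_of_memLp hb hf)
    ((summable_blockVariancePi_walshCoeffDPi_ite hb hf
      fun ℓ : ι → ℕ => ∑ i, ℓ i ≤ m - t).hasSum.mul_left _)
  split_ifs with hle
  · rw [mul_zero]
  · have hℓ0 : ℓ ≠ 0 := by
      rintro rfl
      simp at hle
    exact h.inv_sq_mul_gainFactorPi_mul_le hb hℓ0 (blockVariancePi_nonneg _ ℓ)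

/-- **Owen's variance bound, total-variance form, `f ∈ L_2`** [cite: Owen1998, Thm. 1] (eq. (12));
[cite: Lemieux2009, Prop. 6.4]: for a scrambled `(t, m, s)`-net in base `b` (`N = b^m` points) and
`f ∈ L_2` with variance `Var[f] = ∫ |f - ∫ f|² = Σ_{𝓵 ≠ 0} σ_𝓵²(f)` (eq. (13.12)),
`Var[Î(f)] ≤ (b^t/N) ((b+1)/(b-1))^s Var[f]` — at most `b^t ((b+1)/(b-1))^s` times the Monte
Carlo variance `Var[f]/N`. -/
theorem IsDigitNetPi.integral_norm_sq_scrambledAveragePi_sub_le_of_memLp (hb : 1 < b) {t m : ℕ}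
    {ξ : κ → ι → ℕ → Fin b} (h : IsDigitNetPi b t m ξ) {f : (ι → ℕ → Fin b) → ℂ}
    (hf : MemLp f 2 (digitSeqMeasurePi b ι)) :
    ∫ π, ‖scrambledAveragePi b π ξ f - ∫ η, f η ∂digitSeqMeasurePi b ι‖ ^ 2 ∂scrambleMeasurePi b ι ≤
      (b : ℝ) ^ t / (b : ℝ) ^ m * (((b : ℝ) + 1) / ((b : ℝ) - 1)) ^ Fintype.card ι *
        ∫ η, ‖f η - ∫ ζ, f ζ ∂digitSeqMeasurePi b ι‖ ^ 2 ∂digitSeqMeasurePi b ι := by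
  haveI := h.nonempty'
  refine hasSum_le (fun ℓ => ?_) (hasSum_gainFactorPi_mul_blockVariancePi hb ξ hf)
    ((hasSum_blockVariancePi_walshCoeffDPi_ite hb hf).mul_left _)
  split_ifs with hℓ0
  · rw [mul_zero]
  · exact h.inv_sq_mul_gainFactorPi_mul_le hb hℓ0 (blockVariancePi_nonneg _ ℓ)

end MainL2

/-! ### Corollary 13.7 and Theorem 13.9 (scrambled digital nets) for square-integrable integrands -/

section DigitalL2

variable [NeZero b] [DecidableEq ι] {m p : ℕ}

/-- **Corollary 13.7 for `f ∈ L_2`** [cite: DickPillichshammer2010, Cor. 13.7]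
(`Var[Î(f)] = Σ_{∅ ≠ 𝔲 ⊆ I_s} (b/(b-1))^{|𝔲|} Σ_{𝓵_𝔲 ∈ ℕ^{|𝔲|}} b^{-|𝓵|_1} σ²_{(𝓵_𝔲,0)}(f)
|L_{(𝓵_𝔲,0)} ∩ 𝓓_∞|`; Yue–Hickernell [DP2010, ref. 270]): for `f ∈ L_2`, `b ≥ 2`, and the digital
net generated by `C_1, …, C_s ∈ ℤ_b^{p × m}` randomised by Owen's scrambling,
`Var[Î(f)] = E|Î(f) - ∫ f|² = Σ_{𝓵 ∈ ℕ₀ˢ ∖ {0}} (b/(b-1))^{|𝔲(𝓵)|} b^{-|𝓵|_1} |L_𝓵 ∩ 𝓓_∞| σ_𝓵²(f)`,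
an unconditionally convergent series (`𝔲(𝓵)` the support of `𝓵`, `𝓓_∞` the dual net; the book:
`b` prime, `p = m`). The Walsh-polynomial case is
`integral_norm_sq_scrambledAveragePi_digitalNet_sub_eq`. -/
theorem hasSum_gainWeight_mul_card_mul_blockVariancePi (hb : 1 < b)
    (C : ι → Matrix (Fin p) (Fin m) (ZMod b)) {f : (ι → ℕ → Fin b) → ℂ}
    (hf : MemLp f 2 (digitSeqMeasurePi b ι)) :
    HasSum (fun ℓ : ι → ℕ => if ℓ = 0 then 0 else
        gainWeight b ℓ * (((lengthClass b ℓ).filter (· ∈ dualNet C)).card : ℝ) *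
          blockVariancePi b (walshCoeffDPi b f) ℓ)
      (∫ π, ‖scrambledAveragePi b π (digitalNetDigits C) f - ∫ η, f η ∂digitSeqMeasurePi b ι‖ ^ 2
        ∂scrambleMeasurePi b ι) := by
  haveI : Nonempty (Fin m → ZMod b) := ⟨0⟩
  have hB : (b : ℝ) ^ m ≠ 0 := pow_ne_zero _ (by exact_mod_cast (NeZero.ne b))
  have heq : (fun ℓ : ι → ℕ => if ℓ = 0 then (0 : ℝ) else
      ((Fintype.card (Fin m → ZMod b) : ℝ) ^ 2)⁻¹ * (gainFactorPi b ℓ (digitalNetDigits C) *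
        blockVariancePi b (walshCoeffDPi b f) ℓ)) =
      fun ℓ => if ℓ = 0 then 0 else
        gainWeight b ℓ * (((lengthClass b ℓ).filter (· ∈ dualNet C)).card : ℝ) *
          blockVariancePi b (walshCoeffDPi b f) ℓ := by
    funext ℓ
    split_ifs
    · rfl
    · rw [card_index, gainFactorPi_digitalNetDigits_eq hb]
      push_cast
      field_simp
  rw [← heq]
  exact hasSum_gainFactorPi_mul_blockVariancePi hb (digitalNetDigits C) hf

/-- **Variance of a scrambled digital `(t, m, s)`-net for `f ∈ L_2`, exact form**
[cite: DickPillichshammer2010, Cor. 13.7] with the first case of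
[cite: DickPillichshammer2010, Lemma 13.8] (`|L_𝓵 ∩ 𝓓_∞| = 0` for `|𝓵|_1 ≤ m - t`): only the
digit-length vectors with `|𝓵|_1 > m - t` contribute,
`Var[Î(f)] = Σ_{𝓵 ∈ ℕ₀ˢ, |𝓵|_1 > m-t} (b/(b-1))^{|𝔲(𝓵)|} b^{-|𝓵|_1} |L_𝓵 ∩ 𝓓_∞| σ_𝓵²(f)`. -/
theorem IsDigitalTMSNet.hasSum_gainWeight_mul_card_mul_blockVariancePi_of_memLp (hb : 1 < b)
    {t : ℕ} {C : ι → Matrix (Fin p) (Fin m) (ZMod b)} (hC : IsDigitalTMSNet t C)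
    {f : (ι → ℕ → Fin b) → ℂ} (hf : MemLp f 2 (digitSeqMeasurePi b ι)) :
    HasSum (fun ℓ : ι → ℕ => if ∑ j, ℓ j ≤ m - t then 0 else
        gainWeight b ℓ * (((lengthClass b ℓ).filter (· ∈ dualNet C)).card : ℝ) *
          blockVariancePi b (walshCoeffDPi b f) ℓ)
      (∫ π, ‖scrambledAveragePi b π (digitalNetDigits C) f - ∫ η, f η ∂digitSeqMeasurePi b ι‖ ^ 2
        ∂scrambleMeasurePi b ι) := by
  have heq : (fun ℓ : ι → ℕ => if ∑ j, ℓ j ≤ m - t then (0 : ℝ) else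
      gainWeight b ℓ * (((lengthClass b ℓ).filter (· ∈ dualNet C)).card : ℝ) *
        blockVariancePi b (walshCoeffDPi b f) ℓ) =
      fun ℓ => if ℓ = 0 then 0 else
        gainWeight b ℓ * (((lengthClass b ℓ).filter (· ∈ dualNet C)).card : ℝ) *
          blockVariancePi b (walshCoeffDPi b f) ℓ := by
    funext ℓ
    by_cases hℓ0 : ℓ = 0
    · subst hℓ0
      simp
    · rw [if_neg hℓ0]
      split_ifs with hle
      · rw [hC.card_filter_dualNet_eq_zero hb hℓ0 hle, Nat.cast_zero, mul_zero, zero_mul]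
      · rfl
  rw [heq]
  exact hasSum_gainWeight_mul_card_mul_blockVariancePi hb C hf

/-- One term of Theorem 13.9: `(b/(b-1))^{|𝔲|} b^{-|𝓵|_1} |L_𝓵 ∩ 𝓓_∞| x ≤ b^{-m+t+s} x` for
`𝓵 ≠ 0`, `x ≥ 0` (Lemma 13.8: `N G_𝓵 ≤ b^{t+s}`). [cite: DickPillichshammer2010, Thm. 13.9] -/
private theorem IsDigitalTMSNet.gainWeight_mul_card_mul_le (hb : 1 < b) {t : ℕ}
    {C : ι → Matrix (Fin p) (Fin m) (ZMod b)} (hC : IsDigitalTMSNet t C) {ℓ : ι → ℕ}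
    (hℓ0 : ℓ ≠ 0) {x : ℝ} (hx : 0 ≤ x) :
    gainWeight b ℓ * (((lengthClass b ℓ).filter (· ∈ dualNet C)).card : ℝ) * x ≤
      (b : ℝ) ^ t * (b : ℝ) ^ Fintype.card ι / (b : ℝ) ^ m * x := by
  refine mul_le_mul_of_nonneg_right ?_ hx
  have hB : (0 : ℝ) < (b : ℝ) ^ m := pow_pos (by exact_mod_cast Nat.zero_lt_of_lt hb) m
  have h := hC.gainFactorPi_le_card hb hℓ0
  rw [gainFactorPi_digitalNetDigits_eq hb] at h
  rw [le_div_iff₀ hB]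
  refine le_of_mul_le_mul_right ?_ hB
  calc gainWeight b ℓ * (((lengthClass b ℓ).filter (· ∈ dualNet C)).card : ℝ) * (b : ℝ) ^ m *
          (b : ℝ) ^ m
      = gainWeight b ℓ * ((b : ℝ) ^ m) ^ 2 *
          (((lengthClass b ℓ).filter (· ∈ dualNet C)).card : ℝ) := by ring
    _ ≤ (b : ℝ) ^ m * (b : ℝ) ^ t * (b : ℝ) ^ Fintype.card ι := h
    _ = (b : ℝ) ^ t * (b : ℝ) ^ Fintype.card ι * (b : ℝ) ^ m := by ring

/-- **Theorem 13.9 for `f ∈ L_2`** [cite: DickPillichshammer2010, Thm. 13.9]: let `f ∈ L_2`,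
`b ≥ 2`, and let the `b^m` points be a digital `(t, m, s)`-net over `ℤ_b` (generating matrices
`C_1, …, C_s ∈ ℤ_b^{p × m}`), randomised by Owen's scrambling. Then
`Var[Î(f)] = E|Î(f) - ∫ f|² ≤ b^{-m+t+s} Σ_{𝓵 ∈ ℕ₀ˢ, |𝓵|_1 > m-t} σ_𝓵²(f)`
(the book: `b` prime, `p = m`; any `b ≥ 2` and precision `p` work). The Walsh-polynomial case is
`IsDigitalTMSNet.integral_norm_sq_scrambledAveragePi_sub_le`. -/
theorem IsDigitalTMSNet.integral_norm_sq_scrambledAveragePi_sub_le_tsum_of_memLp (hb : 1 < b)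
    {t : ℕ} {C : ι → Matrix (Fin p) (Fin m) (ZMod b)} (hC : IsDigitalTMSNet t C)
    {f : (ι → ℕ → Fin b) → ℂ} (hf : MemLp f 2 (digitSeqMeasurePi b ι)) :
    ∫ π, ‖scrambledAveragePi b π (digitalNetDigits C) f - ∫ η, f η ∂digitSeqMeasurePi b ι‖ ^ 2
        ∂scrambleMeasurePi b ι ≤
      (b : ℝ) ^ t * (b : ℝ) ^ Fintype.card ι / (b : ℝ) ^ m *
        ∑' ℓ : ι → ℕ, if ∑ j, ℓ j ≤ m - t then 0 else blockVariancePi b (walshCoeffDPi b f) ℓ := by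
  refine hasSum_le (fun ℓ => ?_) (hC.hasSum_gainWeight_mul_card_mul_blockVariancePi_of_memLp hb hf)
    ((summable_blockVariancePi_walshCoeffDPi_ite hb hf
      fun ℓ : ι → ℕ => ∑ j, ℓ j ≤ m - t).hasSum.mul_left _)
  split_ifs with hle
  · rw [mul_zero]
  · have hℓ0 : ℓ ≠ 0 := by
      rintro rfl
      simp at hle
    exact hC.gainWeight_mul_card_mul_le hb hℓ0 (blockVariancePi_nonneg _ ℓ)

/-- **Theorem 13.9, total-variance form, `f ∈ L_2`** [cite: DickPillichshammer2010, Thm. 13.9]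
(and the discussion after it: for MC `N Var[Î(f)] = Σ_{𝓵 ≠ 0} σ_𝓵²(f)`, so a scrambled digital
`(t, m, s)`-net is at most `b^{t+s}` times worse and asymptotically better): with
`Var[f] = ∫ |f - ∫ f|² = Σ_{𝓵 ≠ 0} σ_𝓵²(f)` (eq. (13.12)),
`Var[Î(f)] ≤ (b^{t+s}/N) Var[f]`, `N = b^m`. -/
theorem IsDigitalTMSNet.integral_norm_sq_scrambledAveragePi_sub_le_of_memLp (hb : 1 < b) {t : ℕ}
    {C : ι → Matrix (Fin p) (Fin m) (ZMod b)} (hC : IsDigitalTMSNet t C)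
    {f : (ι → ℕ → Fin b) → ℂ} (hf : MemLp f 2 (digitSeqMeasurePi b ι)) :
    ∫ π, ‖scrambledAveragePi b π (digitalNetDigits C) f - ∫ η, f η ∂digitSeqMeasurePi b ι‖ ^ 2
        ∂scrambleMeasurePi b ι ≤
      (b : ℝ) ^ t * (b : ℝ) ^ Fintype.card ι / (b : ℝ) ^ m *
        ∫ η, ‖f η - ∫ ζ, f ζ ∂digitSeqMeasurePi b ι‖ ^ 2 ∂digitSeqMeasurePi b ι := by
  refine hasSum_le (fun ℓ => ?_) (hasSum_gainWeight_mul_card_mul_blockVariancePi hb C hf)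
    ((hasSum_blockVariancePi_walshCoeffDPi_ite hb hf).mul_left _)
  split_ifs with hℓ0
  · rw [mul_zero]
  · exact hC.gainWeight_mul_card_mul_le hb hℓ0 (blockVariancePi_nonneg _ ℓ)

end DigitalL2

end Literature.Analysis.Quadrature
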